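import Summits.Ventures.YMGap.RobustBall.StarDoorZdWOsc
import Summits.Ventures.YMGap.RobustBall.SummableGlobalLipschitz
import HarnessLib

/-!
# Venture YMGap, track ROBUST-BALL (Y2) — crux Y2-X2-WZd-M, step 1b/2: the weighted star door for a QUASILOCAL
# observable, and the MASSIVE BRIDGE through the star door

HONEST FRAMING. WHAT THIS IS: a venture file (cell `pub-ymgap`, track Y2 ROBUST-BALL, seat ds-2), strong-coupling
LATTICE statement for `SU(N)` lattice Yang–Mills on `ℤ^d` with a PERTURBED action `N β S_W + W`, `W` a SUMMABLE
(infinite-range) link potential (rb-p1's `perturbedYMS`).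
* `abs_covariance_le_of_starWindowBoundZdW_quasilocal` — the weighted star door (`StarWindowBoundZdW`, ARBITRARY
  range, `ρ < 1`, rate `t`) against a BOUNDED local `g` of oscillation `≤ S_g`, for a bounded measurable QUASILOCAL
  `f` with a GLOBAL summable Lipschitz vector `δ` (`|f σ − f τ| ≤ Σ'_y δ(y) ‖σ_y − τ_y‖_F` for ALL `σ, τ`, Föllmer's
  class `L`): `|cov_μ(f, g)| ≤ 2 S_g (2√N) e^{2t} Σ'_y e^{−t·dist(y, Δg)} δ(y)` for every Gibbs measure `μ` (from the
  local form `abs_covariance_le_of_starWindowBoundZdW_osc` through the local approximations `f ∘ (Λ.piecewise · 1)`).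
* `perturbedS_covariance_decay_of_starWindowBoundZdW` — **THE MASSIVE BRIDGE THROUGH THE STAR DOOR**: for a summable
  member with continuous own-link terms, Lipschitz witnesses with summable cross moduli dominated off the diagonal by
  `ℓ(e, y)`, diagonal-free weighted rows `Σ'_y 𝟙[y ≠ e] ℓ(e, y) e^{t‖e − y‖} ≤ Λ_t`, IF `perturbedYMS (fundamentalRep (Fin N)) b W`
  carries the weighted star window bound at rate `t > 0` (`ρ < 1`), then for every DLR state `μ` and every pair of
  bounded measurable LOCAL observables `F₁, F₂`: `|cov_μ(F₁, F₂ ∘ θ_x)| ≤ C e^{−t‖x‖_∞}` — the body of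
  `IsMassiveState`. Method = ds-3's `perturbedS_covariance_decay_quasilocal` (`SummableMassiveBridge.lean`, followed
  line by line: DLR smoothing of `F₁` only, ds-3's global Lipschitz vector `exists_globalLip_specAvg_perturbedYMS`)
  with the one-site Dobrushin–Föllmer estimate replaced by the quasilocal star estimate. NO single-link row condition:
  the bridge reaches wherever the robust vertex-star door closes (`SU(2)`, `d = 4`: `β_W ≤ 1/3` on the tier-2 ball,
  `MassiveOnBallZdW.lean`; the pair bridge stops at `β_W ≤ 1/6`).
WHAT THIS IS NOT: no number here; nothing about the continuum, confinement, a transfer-matrix gap or the Clay problem.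
References: H. Föllmer, LNM 1362 (1988) Ch. I Thm. (2.13), Cor. (2.14), (2.20)–(2.24); H. Künsch, CMP 84 (1982);
H.-O. Georgii (2011) Def. 1.23, Prop. 8.8, Remark 8.26; K. Osterwalder, E. Seiler, Ann. Phys. 110 (1978) §4.
-/

noncomputable section

open MeasureTheory ProbabilityTheory Function Finset Filter Topology
open scoped NNReal
open Literature.Probability.LatticeModels
open Literature.Probability.LatticeModels.DobrushinMetric
open Literature.MathematicalPhysics.QuantumLattice
open Literature.MathematicalPhysics.QuantumFieldTheory hiding ZdEdge
open Literature.MathematicalPhysics.QuantumFieldTheory.Balaban1983to89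
open Literature.MathematicalPhysics.QuantumFieldTheory.Balaban1983to89.StrongCouplingTorusWindow
open Summit.Ventures.YMGap.DSWindowZd
open Summit.Ventures.YMGap.ZdSmoothing

namespace Summit.Ventures.YMGap.RobustBall

variable {d N : ℕ}

section Abstract

variable {V S : Type*} [MeasurableSpace S]

/-- Covariance of two bounded measurable observables under a probability measure: `|cov(h, g)| ≤ 2 B_h B_g`
(private copy; rb-p1's `SourceGeometry.lean` has the public one). [folklore] -/
private theorem abs_covariance_le_two_mul' {μ : Measure (V → S)} [IsProbabilityMeasure μ]
    {h g : (V → S) → ℝ} (hhm : Measurable h) (hgm : Measurable g) {Bh Bg : ℝ} (hBh : ∀ σ, |h σ| ≤ Bh)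
    (hBg : ∀ σ, |g σ| ≤ Bg) : |cov[h, g; μ]| ≤ 2 * Bh * Bg := by
  obtain ⟨σ₀, -⟩ := nonempty_of_measure_ne_zero (μ := μ) (s := Set.univ) (by simp)
  have hBh0 : 0 ≤ Bh := (abs_nonneg _).trans (hBh σ₀)
  rw [covariance_eq_sub
    (memLp_of_bounded (a := -Bh) (b := Bh) (ae_of_all _ fun σ => abs_le.1 (hBh σ)) hhm.aestronglyMeasurable 2)
    (memLp_of_bounded (a := -Bg) (b := Bg) (ae_of_all _ fun σ => abs_le.1 (hBg σ)) hgm.aestronglyMeasurable 2)]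
  have e1 : |∫ σ, (h * g) σ ∂μ| ≤ Bh * Bg :=
    StrongCouplingTorusWindow.abs_integral_le_of_abs_le fun σ => abs_mul_le_of_abs_le hBh hBg σ
  have e2 : |(∫ σ, h σ ∂μ) * ∫ σ, g σ ∂μ| ≤ Bh * Bg := by
    rw [abs_mul]
    exact mul_le_mul (StrongCouplingTorusWindow.abs_integral_le_of_abs_le hBh)
      (StrongCouplingTorusWindow.abs_integral_le_of_abs_le hBg) (abs_nonneg _) hBh0
  refine (abs_sub _ _).trans ?_
  linarith

end Abstract

/-- Finite partial sum plus tail of a summable function (the exterior as an indicator). [folklore] -/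
private theorem sum_add_tsum_ite {ι : Type*} [DecidableEq ι] {a : ι → ℝ} (hs : Summable a)
    (Λ : Finset ι) : ∑ y ∈ Λ, a y + ∑' y, (if y ∈ Λ then (0 : ℝ) else a y) = ∑' y, a y := by
  have h1 : Summable fun y => if y ∈ Λ then a y else (0 : ℝ) :=
    summable_of_ne_finset_zero (s := Λ) fun y hy => if_neg hy
  have h2 : Summable fun y => if y ∈ Λ then (0 : ℝ) else a y := by
    have : (fun y => if y ∈ Λ then (0 : ℝ) else a y) = fun y => a y - (if y ∈ Λ then a y else 0) :=
      funext fun y => by split_ifs <;> ring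
    rw [this]; exact hs.sub h1
  have h3 : ∑' y, (if y ∈ Λ then a y else (0 : ℝ)) = ∑ y ∈ Λ, a y := by
    rw [tsum_eq_sum (s := Λ) (fun y hy => if_neg hy)]
    exact Finset.sum_congr rfl fun y hy => if_pos hy
  rw [← h3, ← h1.tsum_add h2]
  exact tsum_congr fun y => by split_ifs <;> ring

/-- **EXPONENTIAL CLUSTERING through the weighted star door for a QUASILOCAL observable against a BOUNDED local
one.** Same door, `μ` and `g` as in `abs_covariance_le_of_starWindowBoundZdW_osc`; `f` bounded measurable with a
GLOBAL summable Lipschitz vector `δ ≥ 0` (`|f σ − f τ| ≤ Σ'_y δ(y) ‖σ_y − τ_y‖_F` for ALL `σ, τ`; Föllmer's class `L`):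
`|cov_μ(f, g)| ≤ 2 S_g (2√N) e^{2t} Σ'_y e^{−t·dist(y, Δg)} δ(y)` (local approximations `f ∘ (Λ.piecewise · 1)`,
`‖f − f_Λ‖_∞ ≤ 2√N Σ'_{y ∉ Λ} δ(y) → 0`). [folklore] -/
theorem abs_covariance_le_of_starWindowBoundZdW_quasilocal {γ : Specification (ZdEdge d) (SUN N)}
    (hγ : IsSpecification γ) {t ρ : ℝ} (ht : 0 ≤ t) (hρ0 : 0 ≤ ρ) (hρ1 : ρ < 1)
    {reach : Site d → ZdEdge d → ℝ} (hreach0 : ∀ s y, 0 ≤ reach s y)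
    (hreach : ∀ (s : Site d), ∀ x ∈ vertexStarZd s, ∀ y : ZdEdge d, ‖x.1 - y.1‖ ≤ reach s y)
    (h : StarWindowBoundZdW d N γ t ρ reach suFrobDist)
    {μ : Measure (LGConfig d (SUN N))} (hμ : IsGibbsMeasure γ μ)
    {f g : LGConfig d (SUN N) → ℝ} (hfm : Measurable f) (hgm : Measurable g) {Bf Bg : ℝ}
    (hBf : ∀ σ, |f σ| ≤ Bf) (hBg : ∀ σ, |g σ| ≤ Bg)
    {δ : ZdEdge d → ℝ} (hδ0 : ∀ y, 0 ≤ δ y) (hδs : Summable δ)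
    (hδ : ∀ σ τ, |f σ - f τ| ≤ ∑' y, δ y * suFrobDist (σ y) (τ y))
    {Δg : Finset (ZdEdge d)} (hgdep : DependsOn g (Δg : Set (ZdEdge d))) {Sg : ℝ}
    (hSg : ∀ σ τ, |g σ - g τ| ≤ Sg) :
    |cov[f, g; μ]| ≤ 2 * Sg * (2 * Real.sqrt N) * Real.exp (2 * t) *
      ∑' y, Real.exp (-(t * linkSetDist Δg y)) * δ y := by
  classical
  haveI := hμ.isProbabilityMeasure
  set R : ℝ := 2 * Real.sqrt N with hRdef
  have hR0 : 0 ≤ R := by rw [hRdef]; positivity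
  have hSg0 : 0 ≤ Sg := (abs_nonneg _).trans (hSg (fun _ => 1) (fun _ => 1))
  have hθ0 : ∀ y, 0 ≤ Real.exp (-(t * linkSetDist Δg y)) := fun y => (Real.exp_pos _).le
  have hθ1 : ∀ y, Real.exp (-(t * linkSetDist Δg y)) ≤ 1 := fun y =>
    Real.exp_le_one_iff.2 (by nlinarith [linkSetDist_nonneg Δg y])
  have hws : Summable fun y => Real.exp (-(t * linkSetDist Δg y)) * δ y :=
    Summable.of_nonneg_of_le (fun y => mul_nonneg (hθ0 y) (hδ0 y))
      (fun y => by simpa using mul_le_mul_of_nonneg_right (hθ1 y) (hδ0 y)) hδs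
  have hprs : ∀ σ τ : LGConfig d (SUN N), Summable fun y => δ y * suFrobDist (σ y) (τ y) := fun σ τ =>
    Summable.of_nonneg_of_le (fun y => mul_nonneg (hδ0 y) (suFrobDist_nonneg _ _))
      (fun y => mul_le_mul_of_nonneg_left (suFrobDist_le _ _) (hδ0 y)) (hδs.mul_right R)
  -- the local approximations
  set pw : Finset (ZdEdge d) → LGConfig d (SUN N) → LGConfig d (SUN N) :=
    fun Λ σ => Λ.piecewise σ (fun _ => (1 : SUN N)) with hpw
  have hpw_mem : ∀ (Λ : Finset (ZdEdge d)) (σ : LGConfig d (SUN N)) {v : ZdEdge d}, v ∈ Λ → pw Λ σ v = σ v :=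
    fun Λ σ v hv => Finset.piecewise_eq_of_mem _ _ _ hv
  have hpw_nmem : ∀ (Λ : Finset (ZdEdge d)) (σ : LGConfig d (SUN N)) {v : ZdEdge d}, v ∉ Λ → pw Λ σ v = 1 :=
    fun Λ σ v hv => Finset.piecewise_eq_of_notMem _ _ _ hv
  have hpwm : ∀ Λ, Measurable (pw Λ) := fun Λ => by
    refine measurable_pi_lambda _ fun v => ?_
    by_cases hv : v ∈ Λ
    · have : (fun σ : LGConfig d (SUN N) => pw Λ σ v) = fun σ => σ v := funext fun σ => hpw_mem Λ σ hv
      rw [this]; exact measurable_pi_apply v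
    · have : (fun σ : LGConfig d (SUN N) => pw Λ σ v) = fun _ => 1 := funext fun σ => hpw_nmem Λ σ hv
      rw [this]; exact measurable_const
  set fl : Finset (ZdEdge d) → LGConfig d (SUN N) → ℝ := fun Λ σ => f (pw Λ σ) with hfl
  have hflm : ∀ Λ, Measurable (fl Λ) := fun Λ => hfm.comp (hpwm Λ)
  have hflB : ∀ Λ σ, |fl Λ σ| ≤ Bf := fun Λ σ => hBf _
  have hfldep : ∀ Λ, DependsOn (fl Λ) (Λ : Set (ZdEdge d)) := fun Λ σ τ hστ => by
    simp only [hfl]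
    congr 1
    funext v
    by_cases hv : v ∈ Λ
    · rw [hpw_mem Λ σ hv, hpw_mem Λ τ hv]
      exact hστ v (Finset.mem_coe.2 hv)
    · rw [hpw_nmem Λ σ hv, hpw_nmem Λ τ hv]
  have hfllip : ∀ Λ, IsLipBound suFrobDist (fl Λ) fun y => if y ∈ Λ then δ y else 0 := by
    intro Λ
    refine ⟨fun y => by split_ifs; exacts [hδ0 y, le_rfl], fun y σ τ hστ => ?_⟩
    by_cases hy : y ∈ Λ
    · rw [if_pos hy]
      have hagree : ∀ z, z ≠ y → pw Λ σ z = pw Λ τ z := fun z hz => by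
        by_cases hz' : z ∈ Λ
        · rw [hpw_mem Λ σ hz', hpw_mem Λ τ hz']; exact hστ z hz
        · rw [hpw_nmem Λ σ hz', hpw_nmem Λ τ hz']
      have h1 := hδ (pw Λ σ) (pw Λ τ)
      rw [tsum_eq_single y (fun z hz => by rw [hagree z hz, suFrobDist_self, mul_zero]),
        hpw_mem Λ σ hy, hpw_mem Λ τ hy] at h1
      exact h1
    · rw [if_neg hy, zero_mul]
      have hagree : pw Λ σ = pw Λ τ := funext fun z => by
        by_cases hz' : z ∈ Λ
        · have hz : z ≠ y := fun h => hy (h ▸ hz')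
          rw [hpw_mem Λ σ hz', hpw_mem Λ τ hz']; exact hστ z hz
        · rw [hpw_nmem Λ σ hz', hpw_nmem Λ τ hz']
      have : fl Λ σ = fl Λ τ := by simp only [hfl, hagree]
      rw [this, sub_self, abs_zero]
  -- the tail of `δ` outside `Λ` controls `‖f - f_Λ‖_∞`
  set tail : Finset (ZdEdge d) → ℝ := fun Λ => ∑' y, (if y ∈ Λ then 0 else δ y) with htail
  have htail0 : ∀ Λ, 0 ≤ tail Λ := fun Λ => tsum_nonneg fun y => by split_ifs; exacts [le_rfl, hδ0 y]
  have htails : ∀ Λ : Finset (ZdEdge d), Summable fun y => if y ∈ Λ then (0 : ℝ) else δ y := fun Λ =>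
    Summable.of_nonneg_of_le (fun y => by split_ifs; exacts [le_rfl, hδ0 y])
      (fun y => by split_ifs; exacts [hδ0 y, le_rfl]) hδs
  have happrox : ∀ Λ σ, |f σ - fl Λ σ| ≤ R * tail Λ := by
    intro Λ σ
    refine (hδ σ (pw Λ σ)).trans ?_
    have hterm : ∀ y, δ y * suFrobDist (σ y) (pw Λ σ y) ≤ (if y ∈ Λ then 0 else δ y) * R := fun y => by
      by_cases hy : y ∈ Λ
      · rw [hpw_mem Λ σ hy, suFrobDist_self, mul_zero, if_pos hy, zero_mul]
      · rw [if_neg hy]; exact mul_le_mul_of_nonneg_left (suFrobDist_le _ _) (hδ0 y)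
    calc ∑' y, δ y * suFrobDist (σ y) (pw Λ σ y) ≤ ∑' y, (if y ∈ Λ then 0 else δ y) * R :=
          (hprs σ (pw Λ σ)).tsum_le_tsum hterm ((htails Λ).mul_right R)
      _ = R * tail Λ := by rw [tsum_mul_right, mul_comm]
  -- the local bound, uniform in `Λ`
  have hloc : ∀ Λ, |cov[fl Λ, g; μ]| ≤ 2 * Sg * R * Real.exp (2 * t) *
      ∑' y, Real.exp (-(t * linkSetDist Δg y)) * δ y := by
    intro Λ
    have h1 := abs_covariance_le_of_starWindowBoundZdW_osc hγ ht hρ0 hρ1 hreach0 hreach h hμ (hflm Λ) hgm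
      (hflB Λ) hBg (hfldep Λ) hgdep (hfllip Λ) hSg
    refine h1.trans (mul_le_mul_of_nonneg_left ?_ (by positivity))
    calc ∑ x ∈ Λ, Real.exp (-(t * linkSetDist Δg x)) * (if x ∈ Λ then δ x else 0)
        = ∑ x ∈ Λ, Real.exp (-(t * linkSetDist Δg x)) * δ x :=
          Finset.sum_congr rfl fun x hx => by rw [if_pos hx]
      _ ≤ ∑' y, Real.exp (-(t * linkSetDist Δg y)) * δ y :=
          hws.sum_le_tsum Λ fun y _ => mul_nonneg (hθ0 y) (hδ0 y)
  -- the covariance is continuous in `f` for the sup-norm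
  have hcovapprox : ∀ Λ, |cov[f, g; μ]| ≤ |cov[fl Λ, g; μ]| + 2 * (R * tail Λ) * Bg := by
    intro Λ
    have hmf : MemLp f 2 μ := memLp_of_bounded (a := -Bf) (b := Bf)
      (ae_of_all _ fun σ => abs_le.1 (hBf σ)) hfm.aestronglyMeasurable 2
    have hmfl : MemLp (fl Λ) 2 μ := memLp_of_bounded (a := -Bf) (b := Bf)
      (ae_of_all _ fun σ => abs_le.1 (hflB Λ σ)) (hflm Λ).aestronglyMeasurable 2
    have hmg : MemLp g 2 μ := memLp_of_bounded (a := -Bg) (b := Bg)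
      (ae_of_all _ fun σ => abs_le.1 (hBg σ)) hgm.aestronglyMeasurable 2
    have hsub : cov[f - fl Λ, g; μ] = cov[f, g; μ] - cov[fl Λ, g; μ] := covariance_sub_left hmf hmfl hmg
    have hdiff : |cov[f - fl Λ, g; μ]| ≤ 2 * (R * tail Λ) * Bg :=
      abs_covariance_le_two_mul' (hfm.sub (hflm Λ)) hgm (fun σ => happrox Λ σ) hBg
    rw [hsub] at hdiff
    have := abs_sub_abs_le_abs_sub (cov[f, g; μ]) (cov[fl Λ, g; μ])
    linarith
  -- let the tail go to zero along finite sets: `tail Λ = Σ' δ − Σ_Λ δ → 0`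
  set A : ℝ := 2 * Sg * R * Real.exp (2 * t) * ∑' y, Real.exp (-(t * linkSetDist Δg y)) * δ y with hA
  have htend : Tendsto (fun Λ : Finset (ZdEdge d) => A + 2 * (R * tail Λ) * Bg) atTop (𝓝 (A + 2 * (R * 0) * Bg)) := by
    have h1 : Tendsto (fun Λ : Finset (ZdEdge d) => ∑ y ∈ Λ, δ y) atTop (𝓝 (∑' y, δ y)) := hδs.hasSum
    have h2 : Tendsto tail atTop (𝓝 (∑' y, δ y - ∑' y, δ y)) := by
      refine (tendsto_const_nhds.sub h1).congr fun Λ => ?_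
      have := sum_add_tsum_ite hδs Λ
      simp only [htail]; linarith
    rw [sub_self] at h2
    exact tendsto_const_nhds.add ((h2.const_mul R).const_mul 2 |>.mul_const Bg)
  have hlim : A + 2 * (R * 0) * Bg = A := by ring
  rw [hlim] at htend
  exact ge_of_tendsto' htend fun Λ => by linarith [hcovapprox Λ, hloc Λ]

/-! ### The massive bridge through the weighted star door -/

section SUN

variable {W : Potential (ZdEdge d) (Matrix.specialUnitaryGroup (Fin N) ℂ)} {B : Finset (ZdEdge d) → ℝ}

/-- **Exponential clustering of ALL bounded measurable local observables under every DLR state of a summable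
member THROUGH THE WEIGHTED STAR DOOR, at the rate `t` of the door** (`SU(N)`, `N ≥ 1`, every `d ≥ 1`, tree
coupling `b`): for a summable member `W` with continuous own-link terms, Lipschitz witnesses `lip` with summable
cross moduli dominated off the diagonal by `ℓ(e, y)`, diagonal-free weighted rows
`Σ'_y 𝟙[y ≠ e] ℓ(e, y) e^{t‖e − y‖} ≤ Λ_t` (`t > 0`), and the weighted star window bound for
`perturbedYMS (fundamentalRep (Fin N)) b W` with rate `t`, received sum `0 ≤ ρ < 1` and a reach dominating the
sup-distance from the star: for every DLR state `μ` and every pair of bounded measurable local observables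
`F₁, F₂` there is `C` with `|cov_μ(F₁, F₂ ∘ θ_x)| ≤ C e^{−t‖x‖_∞}` for all `x ∈ ℤ^d`. [folklore] -/
theorem perturbedS_covariance_decay_of_starWindowBoundZdW (hd : 1 ≤ d) (hN : 1 ≤ N) (b : ℝ) {Λt t ρ : ℝ}
    (h : IsLinkSummable W B) (hWc : ∀ X, Continuous (W X))
    (hWdep : ∀ X, DependsOn (W X) (↑X : Set (ZdEdge d)))
    {lip : Finset (ZdEdge d) → ZdEdge d → ℝ} (hlip : ∀ X, IsLipBound suFrobDist (W X) (lip X))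
    {ℓ : ZdEdge d → ZdEdge d → ℝ}
    (hlips : ∀ e y, Summable fun X : Finset (ZdEdge d) => (if e ∈ X ∧ y ∈ X then lip X y else 0))
    (hℓ : ∀ e y, y ≠ e → ∑' X : Finset (ZdEdge d), (if e ∈ X ∧ y ∈ X then lip X y else 0) ≤ ℓ e y)
    (ht : 0 < t) (hℓs : ∀ e, Summable fun y => (if y = e then 0 else ℓ e y) * Real.exp (t * ‖e.1 - y.1‖))
    (hℓt : ∀ e, ∑' y, (if y = e then 0 else ℓ e y) * Real.exp (t * ‖e.1 - y.1‖) ≤ Λt)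
    (hρ0 : 0 ≤ ρ) (hρ1 : ρ < 1)
    {reach : Site d → ZdEdge d → ℝ} (hreach0 : ∀ s y, 0 ≤ reach s y)
    (hreach : ∀ (s : Site d), ∀ x ∈ vertexStarZd s, ∀ y : ZdEdge d, ‖x.1 - y.1‖ ≤ reach s y)
    (hdoor : StarWindowBoundZdW d N (perturbedYMS (d := d) (fundamentalRep (Fin N)) b W) t ρ reach suFrobDist)
    {μ : Measure (LGConfig d (Matrix.specialUnitaryGroup (Fin N) ℂ))}
    (hμ : μ ∈ perturbedGibbsMeasuresS (d := d) (fundamentalRep (Fin N)) b W)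
    (F₁ F₂ : LGConfig d (Matrix.specialUnitaryGroup (Fin N) ℂ) → ℝ)
    (h₁ : Literature.MathematicalPhysics.QuantumLattice.IsLocalObservable F₁)
    (h₂ : Literature.MathematicalPhysics.QuantumLattice.IsLocalObservable F₂) (h₁m : Measurable F₁)
    (h₂m : Measurable F₂) (hb₁ : ∃ C, ∀ U, |F₁ U| ≤ C) (hb₂ : ∃ C, ∀ U, |F₂ U| ≤ C) :
    ∃ C : ℝ, ∀ x : Site d,
      |cov[F₁, fun U => F₂ (Literature.MathematicalPhysics.QuantumLattice.configShift x U); μ]| ≤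
        C * Real.exp (-t * ‖x‖) := by
  classical
  -- adapted from ds-3's `perturbedS_covariance_decay_quasilocal` (`SummableMassiveBridge.lean`): the one-site
  -- comparison is replaced by the weighted star door for a quasilocal observable
  haveI : SecondCountableTopology (Matrix (Fin N) (Fin N) ℂ) :=
    inferInstanceAs (SecondCountableTopology (Fin N → Fin N → ℂ))
  haveI : SecondCountableTopology (Matrix.specialUnitaryGroup (Fin N) ℂ) :=
    Topology.IsEmbedding.subtypeVal.secondCountableTopology
  have hγ : IsSpecification (perturbedYMS (d := d) (fundamentalRep (Fin N)) b W) :=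
    isSpecification_perturbedYMS _ (continuous_fundamentalRep (Fin N)) _ h hWc hWdep
  have hGibbs : IsGibbsMeasure (perturbedYMS (d := d) (fundamentalRep (Fin N)) b W) μ := hμ
  haveI : IsProbabilityMeasure μ := hGibbs.isProbabilityMeasure
  -- supports (made non-empty by adjoining one fixed link) and bounds
  obtain ⟨S₁', hS₁'⟩ := h₁
  obtain ⟨S₂', hS₂'⟩ := h₂
  obtain ⟨M₁, hM₁⟩ := hb₁
  obtain ⟨M₂, hM₂⟩ := hb₂
  set e₀ : ZdEdge d := ((0 : Site d), (⟨0, hd⟩ : Fin d)) with he₀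
  set S₁ : Finset (ZdEdge d) := insert e₀ S₁' with hS₁def
  set S₂ : Finset (ZdEdge d) := insert e₀ S₂' with hS₂def
  have hS₁ : IsCylinder F₁ S₁ :=
    DependsOn.mono (fun e he => Finset.mem_coe.2 (Finset.mem_insert_of_mem (Finset.mem_coe.1 he))) hS₁'
  have hS₂ : IsCylinder F₂ S₂ :=
    DependsOn.mono (fun e he => Finset.mem_coe.2 (Finset.mem_insert_of_mem (Finset.mem_coe.1 he))) hS₂'
  have hS₂ne : S₂.Nonempty := Finset.insert_nonempty _ _
  have hM₁0 : 0 ≤ M₁ := (abs_nonneg _).trans (hM₁ fun _ => 1)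
  have hM₂0 : 0 ≤ M₂ := (abs_nonneg _).trans (hM₂ fun _ => 1)
  -- the displacement bound `D` over `S₁ × S₂` (a double sum dominating every pair distance)
  obtain ⟨D, hDdef⟩ : ∃ D : ℝ, D = ∑ a ∈ S₁, ∑ b ∈ S₂, ‖a.1 - b.1‖ := ⟨_, rfl⟩
  have hD : ∀ a₀ ∈ S₁, ∀ b₀ ∈ S₂, ‖a₀.1 - b₀.1‖ ≤ D := by
    intro a₀ ha₀ b₀ hb₀
    rw [hDdef]
    calc ‖a₀.1 - b₀.1‖ ≤ ∑ b ∈ S₂, ‖a₀.1 - b.1‖ :=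
          Finset.single_le_sum (f := fun b : ZdEdge d => ‖a₀.1 - b.1‖) (fun b _ => norm_nonneg _) hb₀
      _ ≤ ∑ a ∈ S₁, ∑ b ∈ S₂, ‖a.1 - b.1‖ :=
          Finset.single_le_sum (f := fun a : ZdEdge d => ∑ b ∈ S₂, ‖a.1 - b.1‖)
            (fun a _ => Finset.sum_nonneg fun b _ => norm_nonneg _) ha₀
  -- the global Lipschitz vector of the smoothing `f₁ = γ_{S₁} F₁` (ds-3)
  obtain ⟨δ₁, Φ, hΦ0, hδ₁0, hδ₁s, hglobal, hprof⟩ := exists_globalLip_specAvg_perturbedYMS hd hN b h hWc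
    hWdep hlip hlips hℓ ht.le hℓs hℓt S₁ h₁m hS₁ hM₁
  set f₁ : LGConfig d (Matrix.specialUnitaryGroup (Fin N) ℂ) → ℝ :=
    specAvg (perturbedYMS (d := d) (fundamentalRep (Fin N)) b W) S₁ F₁ with hf₁def
  have hf₁m : Measurable f₁ := measurable_specAvg hγ S₁ h₁m
  have hf₁M : ∀ U, |f₁ U| ≤ M₁ := abs_specAvg_le hγ S₁ hM₁
  -- the constant
  set Cfar : ℝ := 2 * (2 * M₂) * (2 * Real.sqrt N) * Real.exp (2 * t) * Φ with hCfar
  have hCfar0 : 0 ≤ Cfar := by positivity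
  refine ⟨(2 * M₁ * M₂ + Cfar) * Real.exp (t * D), fun x => ?_⟩
  set Gx : LGConfig d (Matrix.specialUnitaryGroup (Fin N) ℂ) → ℝ :=
    F₂ ∘ Literature.MathematicalPhysics.QuantumLattice.configShift x with hGxdef
  obtain ⟨S₂x, hS₂x⟩ : ∃ S : Finset (ZdEdge d), S = S₂.image fun e => (e.1 - x, e.2) := ⟨_, rfl⟩
  have hGxS : IsCylinder Gx S₂x := by rw [hS₂x]; exact IsCylinder.comp_configShift hS₂ x
  have hGxm : Measurable Gx := h₂m.comp (Literature.MathematicalPhysics.QuantumLattice.configShift x).measurable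
  have hGxM : ∀ U, |Gx U| ≤ M₂ := fun U => hM₂ _
  have hGxosc : ∀ U V, |Gx U - Gx V| ≤ 2 * M₂ := fun U V =>
    (abs_sub _ _).trans (by linarith [hGxM U, hGxM V])
  have hS₂xne : S₂x.Nonempty := by rw [hS₂x]; exact hS₂ne.image _
  have hL2 : ∀ {f : LGConfig d (Matrix.specialUnitaryGroup (Fin N) ℂ) → ℝ} {M : ℝ}, Measurable f →
      (∀ U, |f U| ≤ M) → MemLp f 2 μ := fun hf hfM =>
    memLp_of_bounded (ae_of_all _ fun U => abs_le.1 (hfM U)) hf.aestronglyMeasurable 2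
  have hcov : cov[F₁, fun U => F₂ (Literature.MathematicalPhysics.QuantumLattice.configShift x U); μ] =
      (∫ U, F₁ U * Gx U ∂μ) - (∫ U, F₁ U ∂μ) * ∫ U, Gx U ∂μ :=
    covariance_eq_sub (hL2 h₁m hM₁) (hL2 hGxm hGxM)
  have hexp0 : 0 < Real.exp (-t * ‖x‖) := Real.exp_pos _
  by_cases hnear : ‖x‖ ≤ D
  · -- NEAR: the trivial bound `|cov| ≤ 2 M₁ M₂` and `e^{tD} e^{-t‖x‖} ≥ 1`
    rw [hcov]
    have htriv : |(∫ U, F₁ U * Gx U ∂μ) - (∫ U, F₁ U ∂μ) * ∫ U, Gx U ∂μ| ≤ 2 * M₁ * M₂ := by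
      refine (abs_sub _ _).trans ?_
      have e1 := StrongCouplingTorusWindow.abs_integral_le_of_abs_le (μ := μ) (abs_mul_le_of_abs_le hM₁ hGxM)
      have e2 : |(∫ U, F₁ U ∂μ) * ∫ U, Gx U ∂μ| ≤ M₁ * M₂ := by
        rw [abs_mul]
        exact mul_le_mul (StrongCouplingTorusWindow.abs_integral_le_of_abs_le hM₁)
          (StrongCouplingTorusWindow.abs_integral_le_of_abs_le hGxM) (abs_nonneg _) hM₁0
      linarith
    have hone : 1 ≤ Real.exp (t * D) * Real.exp (-t * ‖x‖) := by
      rw [← Real.exp_add]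
      refine Real.one_le_exp ?_
      have := mul_le_mul_of_nonneg_left hnear ht.le
      linarith
    refine htriv.trans ?_
    have h2MM : 0 ≤ 2 * M₁ * M₂ := by positivity
    calc 2 * M₁ * M₂ ≤ 2 * M₁ * M₂ * (Real.exp (t * D) * Real.exp (-t * ‖x‖)) := le_mul_of_one_le_right h2MM hone
      _ ≤ (2 * M₁ * M₂ + Cfar) * (Real.exp (t * D) * Real.exp (-t * ‖x‖)) :=
          mul_le_mul_of_nonneg_right (le_add_of_nonneg_right hCfar0) (mul_nonneg (Real.exp_pos _).le hexp0.le)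
      _ = (2 * M₁ * M₂ + Cfar) * Real.exp (t * D) * Real.exp (-t * ‖x‖) := by ring
  -- FAR: `D < ‖x‖`; `S₁ ∩ (S₂ − x) = ∅` and `dist(S₁, S₂ − x) ≥ ‖x‖ − D`
  rw [not_le] at hnear
  have hfar : ∀ a₀ ∈ S₁, ∀ b' ∈ S₂x, ‖x‖ - D ≤ ‖a₀.1 - b'.1‖ := by
    intro a₀ ha₀ b' hb'
    rw [hS₂x] at hb'
    obtain ⟨b₀, hb₀, rfl⟩ := Finset.mem_image.1 hb'
    have h1 := hD a₀ ha₀ b₀ hb₀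
    have h2 : ‖x‖ ≤ ‖a₀.1 - (b₀.1 - x)‖ + ‖a₀.1 - b₀.1‖ := by
      have e : x = (a₀.1 - (b₀.1 - x)) - (a₀.1 - b₀.1) := by abel
      calc ‖x‖ = ‖(a₀.1 - (b₀.1 - x)) - (a₀.1 - b₀.1)‖ := by rw [← e]
        _ ≤ ‖a₀.1 - (b₀.1 - x)‖ + ‖a₀.1 - b₀.1‖ := norm_sub_le _ _
    dsimp only
    linarith
  have hdisj : ∀ a₀ ∈ S₁, a₀ ∉ S₂x := by
    intro a₀ ha₀ hb
    have h' := hfar a₀ ha₀ a₀ hb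
    rw [sub_self, norm_zero] at h'
    linarith
  have hm₀ : ∀ e ∈ S₁, ‖x‖ - D ≤ linkSetDist S₂x e := by
    intro e he
    unfold linkSetDist
    rw [dif_pos hS₂xne]
    exact (Finset.le_inf'_iff hS₂xne _).2 fun b' hb' => hfar e he b' hb'
  -- DLR smoothing of `F₁`: the integrals against `Gx` (blind to `S₁`) are unchanged
  have hI₁ : ∫ U, F₁ U * Gx U ∂μ = ∫ U, f₁ U * Gx U ∂μ :=
    (integral_specAvg_mul hγ hGibbs S₁ h₁m hM₁ hGxm hGxM hGxS fun e he heS =>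
      hdisj e he (Finset.mem_coe.1 heS)).symm
  have hI₂ : ∫ U, F₁ U ∂μ = ∫ U, f₁ U ∂μ := (integral_specAvg hγ hGibbs S₁ h₁m hM₁).symm
  have hcov' : cov[F₁, fun U => F₂ (Literature.MathematicalPhysics.QuantumLattice.configShift x U); μ] =
      cov[f₁, Gx; μ] := by
    rw [hcov, hI₁, hI₂]
    exact (covariance_eq_sub (hL2 hf₁m hf₁M) (hL2 hGxm hGxM)).symm
  rw [hcov']
  -- the weighted star door for the quasilocal `f₁` against the bounded local `Gx`
  have key := abs_covariance_le_of_starWindowBoundZdW_quasilocal hγ ht.le hρ0 hρ1 hreach0 hreach hdoor hGibbs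
    hf₁m hGxm hf₁M hGxM hδ₁0 hδ₁s hglobal hGxS hGxosc
  have hsum := hprof S₂x (‖x‖ - D) hm₀
  refine key.trans ?_
  have h22 : 0 ≤ 2 * (2 * M₂) * (2 * Real.sqrt N) * Real.exp (2 * t) := by positivity
  calc 2 * (2 * M₂) * (2 * Real.sqrt N) * Real.exp (2 * t) * ∑' y, Real.exp (-(t * linkSetDist S₂x y)) * δ₁ y
      ≤ 2 * (2 * M₂) * (2 * Real.sqrt N) * Real.exp (2 * t) * (Φ * Real.exp (-(t * (‖x‖ - D)))) :=
        mul_le_mul_of_nonneg_left hsum h22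
    _ = Cfar * Real.exp (t * D) * Real.exp (-t * ‖x‖) := by
        rw [hCfar, show -(t * (‖x‖ - D)) = t * D + -t * ‖x‖ by ring, Real.exp_add]; ring
    _ ≤ (2 * M₁ * M₂ + Cfar) * Real.exp (t * D) * Real.exp (-t * ‖x‖) := by
        refine mul_le_mul_of_nonneg_right (mul_le_mul_of_nonneg_right ?_ (Real.exp_pos _).le) hexp0.le
        exact le_add_of_nonneg_left (by positivity)

end SUN

end Summit.Ventures.YMGap.RobustBall

end
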